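import Summits.Ventures.PercRepro.Night2GoodTwoD2Shape

/-!
# night-2: the loss of a lossy big pair under "at most one fat closure"

The three thin faces of a lossy big set request `Φ/(m + 2)` each with `m ≥ 2`, and at most one of them is fat
(`m = 2`, `fatClosures`): `L1 ≤ 7/24 + 7/30 + 7/30 = 91/120`.  With `capS ≥ 11/18`, the loss factor is
`1 − capS/L1 ≤ 53/273`, so every face of a lossy big pair loses at most `(7/24)(53/273) = 53/936` — the per-pair
constant of the distance-2 accounting (`dshGT2 B z T ≤ (53/936)/|d2Targets|`).
-/

namespace PercRepro.Shadow

open PercRepro.ThmH PercRepro.PerFlat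

variable {α : Type*} [DecidableEq α] {M : Matroid α} [M.Finite] {G : Finset α}

/-- A thin face's request: `≤ 7/30`, plus `7/120` when the face is fat (`|G ∖ clF F| = 2`). -/
theorem req_le_of_thin_split (hG : G ∈ flatsQ M (5 + 1)) (hd : (gr M \ G).card = 2) {F : Finset α}
    (hthin : F ∈ thinMembers M 5 G) :
    req M 5 F ≤ 7 / 30 + (if (G \ clF M F).card = 2 then (7 / 120 : ℚ) else 0) := by
  have hd' : (gr M \ G).card ≤ 5 := by omega
  have hm := two_le_card_sdiff_of_not_lay0 hG hd' (mem_thinMembers.1 hthin).1 (mem_thinMembers.1 hthin).2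
  rw [req_eq_of_thin hG hthin, hd]
  unfold phiQ
  split_ifs with h2
  · rw [h2]
    norm_num
  · have hm3 : 3 ≤ (G \ clF M F).card := by omega
    have hm' : (3 : ℚ) ≤ ((G \ clF M F).card : ℚ) := by exact_mod_cast hm3
    rw [div_le_iff₀ (by linarith)]
    linarith

/-- **At most one fat face**: the closures of distinct thin faces of `Q` differ, so at most one face has
`|G ∖ clF F| = 2` when `G` has at most one fat closure. -/
theorem card_fat_faces_le_one (hG : G ∈ flatsQ M (5 + 1)) (hd : (gr M \ G).card = 2)
    (hk : kColoops M G = 1) (hs : ∀ e ∈ gr M, ∀ f ∈ gr M, e ≠ f → rkN M {e, f} = 2)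
    (hl : ∀ e ∈ gr M, M.Indep {e}) (hfat : (fatClosures M 5 G 2).card ≤ 1) {B : Finset α}
    (hB : B ∈ thinMembers M 5 G) (hbig : 5 ≤ (B \ coloops M G).card) {z : α} (hz : z ∈ G \ clF M B)
    (h : loss M 5 G B z ≠ 0) :
    ((thinFacesOf M 5 G (insert z B)).filter (fun F => (G \ clF M F).card = 2)).card ≤ 1 := by
  have hthin : ∀ F ∈ thinFacesOf M 5 G (insert z B), F ∈ thinMembers M 5 G :=
    fun F hF => mem_thinMembers_of_mem_thinFacesOf hF
  refine le_trans (Finset.card_le_card_of_injOn (fun F => clF M F) ?_ ?_) hfat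
  · intro F hF
    simp only [Finset.mem_coe, Finset.mem_filter] at hF
    unfold fatClosures
    rw [Finset.mem_coe, Finset.mem_image]
    exact ⟨F, Finset.mem_filter.2 ⟨hthin F hF.1, hF.2.le⟩, rfl⟩
  · intro F hF F' hF' heq
    simp only [Finset.mem_coe, Finset.mem_filter] at hF hF'
    have hfaces := thinFacesOf_eq_image_erase hG hd hk hs hl hB hbig hz h
    have hF1 := hF.1
    have hF'1 := hF'.1
    rw [hfaces, Finset.mem_image] at hF1 hF'1
    obtain ⟨w, hw, rfl⟩ := hF1
    obtain ⟨w', hw', rfl⟩ := hF'1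
    by_contra hne
    have hww' : w ≠ w' := by
      rintro rfl
      exact hne rfl
    have hw'Q : w' ∈ insert z B := (Finset.mem_sdiff.1 (mem_coloops.1 hw').1).1
    have hQg : insert z B ⊆ gr M :=
      (Finset.insert_subset (Finset.mem_sdiff.1 hz).1 (subset_G_of_mem_thinMembers hB)).trans
        (mem_flatsQ.1 hG).1
    -- `w' ∈ clF (Q.erase w) = clF (Q.erase w')`, against `w'` being a coloop
    have h1 : w' ∈ clF M ((insert z B).erase w) :=
      subset_clF_of_subset_gr ((Finset.erase_subset _ _).trans hQg) (Finset.mem_erase.2 ⟨hww'.symm, hw'Q⟩)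
    simp only at heq
    rw [heq] at h1
    have h2 : w' ∉ clF M ((insert z B).erase w') := by
      intro h2
      obtain ⟨e₀, he₀⟩ := Finset.card_eq_one.1 (show (coloops M G).card = 1 by
        rw [← kColoops_eq_card_coloops]; exact hk)
      have he₀c : e₀ ∈ coloops M G := he₀ ▸ Finset.mem_singleton_self e₀
      have hw'e : w' ≠ e₀ := fun h' => (Finset.mem_sdiff.1 (mem_coloops.1 hw').1).2 (h' ▸ he₀c)
      have h3 := mem_clF_erase_coloop_of_mem_clF hG he₀c
        ((Finset.erase_subset _ _).trans
          (Finset.insert_subset (Finset.mem_sdiff.1 hz).1 (subset_G_of_mem_thinMembers hB)))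
        ((Finset.insert_subset (Finset.mem_sdiff.1 hz).1 (subset_G_of_mem_thinMembers hB)) hw'Q) hw'e h2
      have heq' : ((insert z B).erase w').erase e₀ = (insert z B \ coloops M G).erase w' := by
        rw [he₀, Finset.sdiff_singleton_eq_erase, Finset.erase_right_comm]
      rw [heq'] at h3
      exact (mem_coloops.1 hw').2 h3
    exact h2 h1

/-- **`L1 ≤ 91/120` for a lossy big set** with at most one fat closure. -/
theorem L1_le_of_loss_ne_zero (hG : G ∈ flatsQ M (5 + 1)) (hd : (gr M \ G).card = 2)
    (hk : kColoops M G = 1) (hs : ∀ e ∈ gr M, ∀ f ∈ gr M, e ≠ f → rkN M {e, f} = 2)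
    (hl : ∀ e ∈ gr M, M.Indep {e}) (hfat : (fatClosures M 5 G 2).card ≤ 1) {B : Finset α}
    (hB : B ∈ thinMembers M 5 G) (hbig : 5 ≤ (B \ coloops M G).card) {z : α} (hz : z ∈ G \ clF M B)
    (h : loss M 5 G B z ≠ 0) : L1 M 5 G (insert z B) ≤ 91 / 120 := by
  have hcard := card_thinFacesOf_eq_three hG hd hk hs hl hB hbig hz h
  have hthin : ∀ F ∈ thinFacesOf M 5 G (insert z B), F ∈ thinMembers M 5 G :=
    fun F hF => mem_thinMembers_of_mem_thinFacesOf hF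
  have hfat1 := card_fat_faces_le_one hG hd hk hs hl hfat hB hbig hz h
  -- the sum
  unfold L1
  have hsum : ∑ F ∈ (coverPreimages M (Uq M (5 + 2) 5) G (insert z B)).filter (fun F => F ∉ lay0 M 5 G),
      req M 5 F ≤ ∑ F ∈ (coverPreimages M (Uq M (5 + 2) 5) G (insert z B)).filter (fun F => F ∉ lay0 M 5 G),
      (7 / 30 + (if (G \ clF M F).card = 2 then (7 / 120 : ℚ) else 0)) := by
    apply Finset.sum_le_sum
    intro F hF
    exact req_le_of_thin_split hG hd (hthin F hF)
  rw [Finset.sum_add_distrib, Finset.sum_const, Finset.sum_ite, Finset.sum_const_zero, add_zero,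
    Finset.sum_const, nsmul_eq_mul, nsmul_eq_mul] at hsum
  have hc3 : (((coverPreimages M (Uq M (5 + 2) 5) G (insert z B)).filter (fun F => F ∉ lay0 M 5 G)).card : ℚ)
      = 3 := by exact_mod_cast hcard
  have hc1 : ((((coverPreimages M (Uq M (5 + 2) 5) G (insert z B)).filter (fun F => F ∉ lay0 M 5 G)).filter
      (fun F => (G \ clF M F).card = 2)).card : ℚ) ≤ 1 := by exact_mod_cast hfat1
  rw [hc3] at hsum
  linarith

/-- **The loss of a face of a lossy big pair is at most `53/936`** (at most one fat closure). -/
theorem loss_le_of_loss_ne_zero (hG : G ∈ flatsQ M (5 + 1)) (hd : (gr M \ G).card = 2)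
    (hk : kColoops M G = 1) (hs : ∀ e ∈ gr M, ∀ f ∈ gr M, e ≠ f → rkN M {e, f} = 2)
    (hl : ∀ e ∈ gr M, M.Indep {e}) (hfat : (fatClosures M 5 G 2).card ≤ 1) {B : Finset α}
    (hB : B ∈ thinMembers M 5 G) (hbig : 5 ≤ (B \ coloops M G).card) {z : α} (hz : z ∈ G \ clF M B)
    (h : loss M 5 G B z ≠ 0) : loss M 5 G B z ≤ 53 / 936 := by
  have hL1 := L1_le_of_loss_ne_zero hG hd hk hs hl hfat hB hbig hz h
  have hQG : insert z B ⊆ G :=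
    Finset.insert_subset (Finset.mem_sdiff.1 hz).1 (subset_G_of_mem_thinMembers hB)
  have hcap := capS_ge_eleven_eighteenths_two_one hd hk hQG
  have hreq := req_le_seven_div_24_of_thin hG hd hB
  have hreq0 := req_nonneg (M := M) 5 B
  have hL : ¬ L1 M 5 G (insert z B) ≤ capS M 5 G (insert z B) := by
    intro hle
    apply h
    unfold loss fS
    rw [if_pos hle]
    ring
  push Not at hL
  unfold loss fS
  rw [if_neg (not_le.2 hL)]
  have hLpos : (0 : ℚ) < L1 M 5 G (insert z B) := by linarith
  have hfac : 1 - capS M 5 G (insert z B) / L1 M 5 G (insert z B) ≤ 53 / 273 := by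
    rw [sub_le_iff_le_add, ← sub_le_iff_le_add', le_div_iff₀ hLpos]
    linarith
  have hfac0 : 0 ≤ 1 - capS M 5 G (insert z B) / L1 M 5 G (insert z B) := by
    rw [sub_nonneg, div_le_one hLpos]
    exact hL.le
  calc req M 5 B * (1 - capS M 5 G (insert z B) / L1 M 5 G (insert z B))
      ≤ (7 / 24) * (53 / 273) := mul_le_mul hreq hfac hfac0 (by norm_num)
    _ = 53 / 936 := by norm_num

/-- **The per-pair share at a distance-2 target**: `dshGT2 B z T ≤ (53/936) / |d2Targets|` for a covered lossy big
pair loading `T` at distance two. -/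
theorem dshGT2_le_of_mem_d2Targets (hG : G ∈ flatsQ M (5 + 1)) (hd : (gr M \ G).card = 2)
    (hk : kColoops M G = 1) (hs : ∀ e ∈ gr M, ∀ f ∈ gr M, e ≠ f → rkN M {e, f} = 2)
    (hl : ∀ e ∈ gr M, M.Indep {e}) (hfat : (fatClosures M 5 G 2).card ≤ 1) {B : Finset α}
    (hB : B ∈ thinMembers M 5 G) (hbig : 5 ≤ (B \ coloops M G).card) {z : α} (hz : z ∈ G \ clF M B)
    (h : loss M 5 G B z ≠ 0) (hno : ¬ (gtPts M 5 G (insert z B)).Nonempty) {T : Finset α}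
    (hT : T ∈ d2Targets M 5 G (insert z B)) :
    dshGT2 M 5 G B z T ≤ (53 / 936) / ((d2Targets M 5 G (insert z B)).card : ℚ) := by
  have hne : (d2Targets M 5 G (insert z B)).Nonempty := ⟨T, hT⟩
  unfold dshGT2
  rw [if_neg hno, if_pos hne, if_pos hT]
  have hpos : (0 : ℚ) < ((d2Targets M 5 G (insert z B)).card : ℚ) := by
    exact_mod_cast Finset.card_pos.2 hne
  exact div_le_div_of_nonneg_right (loss_le_of_loss_ne_zero hG hd hk hs hl hfat hB hbig hz h) hpos.le

end PercRepro.Shadow
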